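import Summits.QuantumAdvantage.QuantumAdvantage.Theorems.SteerDialWords

/-!
# SteerDial (3/7): SteerDialLevel

§L — the LEVEL DIAL `levelWitness3 : SpreadDial.PolyLoss3 → (1/poly loss inside every single Hamming-weight class mod
3)` (word selected by a degree-2 function of the weight) and §S — the WINDOW DIAL `cylinderLoss3_of_polyLoss3` /
`windowLoss3_of_polyLoss3` (loss inside the identity-word cylinders of length 6).

Part 3 of 7 of the prover-side twin of the workshop node «SteerDial» (route `SpreadDial`, node on 29065 `CoverLift3`;
lineage decomp-qadv-lens-5, generation 7).  Content verbatim from the monolithic twin `tree/SpreadDialSteer.lean`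
(sha256 5f501baf…, farm rc0 · 0 err · 0 warn · 0 sorry; axioms `propext`/`Classical.choice`/`Quot.sound` for every theorem),
cut at section boundaries to meet the 400-line rule.  No `def … : Prop`, no `instance`, no `notation`.
-/

set_option linter.style.longLine false
set_option linter.dupNamespace false

namespace Summit.QuantumAdvantage.QuantumAdvantage.Theorems.SteerDial

open Finset
open Literature.Computability.QuantumComplexity Literature.Computability.MetaComplexity
open Literature.Computability.QuantumComplexity.RingHLF
open Summit.QuantumAdvantage.AdviceFreeQNC0
open Summit.QuantumAdvantage.QuantumAdvantage.Theses

/-! ## §L  The level dial: `PolyLoss3 ⇒` loss inside every single level class (a PROVED instance of spread steering at poly-loss grade) -/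

section Level
variable {n : ℕ}

/-- Output bits of an `𝔽₃` strategy. -/
abbrev bits {N : ℕ} (P : Fin N → Smolensky.CubeFn (ZMod 3) N) (x : Fin N → Bool) : Fin N → Bool :=
  fun b => decide (P b x = 1)

/-- The folded strategy's `i`-th output bit as a Boolean function of the short pattern. -/
def foldBit (w α β : Fin 6 → Bool) (a b : Bool) (P : Fin (n + 6) → Smolensky.CubeFn (ZMod 3) (n + 6)) (i : Fin n) :
    (Fin n → Bool) → Bool := fun y => foldOut n α β a b (bits P (pad w y)) i

/-- Restricting a degree-`d` polynomial on `C_{n+6}` to the padded patterns keeps degree `d`. -/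
theorem comp_pad_mem_lowDeg {d : ℕ} (w : Fin 6 → Bool) {Q : Smolensky.CubeFn (ZMod 3) (n + 6)}
    (hQ : Q ∈ Smolensky.lowDeg (ZMod 3) (n + 6) d) :
    (fun y : Fin n → Bool => Q (pad w y)) ∈ Smolensky.lowDeg (ZMod 3) n d := by
  refine Smolensky.comp_subst_mem_lowDeg (fun y : Fin n → Bool => pad w y) (fun b => ?_) hQ
  induction b using Fin.addCases with
  | left i => exact Or.inr ⟨i, fun y => pad_castAdd w y i⟩
  | right j => exact Or.inl ⟨w j, fun y => pad_natAdd w y j⟩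

/-- The block parity used by the fold has degree `≤ 12d`. -/
theorem ind_parityOn_mem_lowDeg {d : ℕ} (w γ : Fin 6 → Bool) {P : Fin (n + 6) → Smolensky.CubeFn (ZMod 3) (n + 6)}
    (hP : ∀ b, P b ∈ Smolensky.lowDeg (ZMod 3) (n + 6) d) :
    ind (fun y : Fin n → Bool => parityOn n γ (bits P (pad w y))) ∈ Smolensky.lowDeg (ZMod 3) n (12 * d) := by
  have h := ind_parity_mem_lowDeg (n := n) (univ.filter fun j : Fin 6 => γ j = true)
    (fun j y => decide (P (Fin.natAdd n j) (pad w y) = 1)) (2 * d)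
    (fun j _ => ind_decide_mem_lowDeg (comp_pad_mem_lowDeg w (hP _)))
  have hfun : (fun y : Fin n → Bool => parityOn n γ (bits P (pad w y))) = fun y =>
      decide (((univ.filter fun j : Fin 6 => γ j = true).filter fun j =>
        decide (P (Fin.natAdd n j) (pad w y) = 1) = true).card % 2 = 1) := by
    funext y
    simp only [parityOn, bits, Finset.filter_filter]
  rw [hfun]
  refine Smolensky.lowDeg_mono ?_ h
  have hc : (univ.filter fun j : Fin 6 => γ j = true).card ≤ 6 :=
    (Finset.card_filter_le _ _).trans (by simp)
  calc (univ.filter fun j : Fin 6 => γ j = true).card * (2 * d) ≤ 6 * (2 * d) := Nat.mul_le_mul_right _ hc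
    _ = 12 * d := by ring

/-- **Degree of the fold**: every folded output bit has degree `≤ 14d`. -/
theorem ind_foldBit_mem_lowDeg {d : ℕ} (w α β : Fin 6 → Bool) (a b : Bool)
    {P : Fin (n + 6) → Smolensky.CubeFn (ZMod 3) (n + 6)} (hP : ∀ b', P b' ∈ Smolensky.lowDeg (ZMod 3) (n + 6) d) (i : Fin n) :
    ind (foldBit w α β a b P i) ∈ Smolensky.lowDeg (ZMod 3) n (14 * d) := by
  have hA : ind (fun y : Fin n → Bool => bits P (pad w y) (Fin.castAdd 6 i)) ∈ Smolensky.lowDeg (ZMod 3) n (2 * d) :=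
    ind_decide_mem_lowDeg (comp_pad_mem_lowDeg w (hP _))
  by_cases h1 : i.val = n - 1
  · have hf : foldBit w α β a b P i = fun y => xor (bits P (pad w y) (Fin.castAdd 6 i)) (xor (parityOn n α (bits P (pad w y))) a) := by
      funext y; simp only [foldBit, foldOut, if_pos h1]
    rw [hf, show 14 * d = 2 * d + (12 * d + 0) by ring]
    exact ind_xor_mem_lowDeg hA (ind_xor_mem_lowDeg (ind_parityOn_mem_lowDeg w α hP) (ind_const_mem_lowDeg a 0))
  · by_cases h0 : i.val = 0
    · have hf : foldBit w α β a b P i = fun y => xor (bits P (pad w y) (Fin.castAdd 6 i)) (xor (parityOn n β (bits P (pad w y))) b) := by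
        funext y; simp only [foldBit, foldOut, if_neg h1, if_pos h0]
      rw [hf, show 14 * d = 2 * d + (12 * d + 0) by ring]
      exact ind_xor_mem_lowDeg hA (ind_xor_mem_lowDeg (ind_parityOn_mem_lowDeg w β hP) (ind_const_mem_lowDeg b 0))
    · have hf : foldBit w α β a b P i = fun y => bits P (pad w y) (Fin.castAdd 6 i) := by
        funext y; simp only [foldBit, foldOut, if_neg h1, if_neg h0, Bool.xor_false]
      rw [hf]
      exact Smolensky.lowDeg_mono (by omega) hA

/-- **The spliced strategy** on `C_n`: at a pattern of level `t = |y| mod 3` play the fold of `P` along the identity word of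
weight `r + 1 - t`, so that the padded pattern always has level EXACTLY `r + 1`. -/
def splice (r : ZMod 3) (P : Fin (n + 6) → Smolensky.CubeFn (ZMod 3) (n + 6)) : Fin n → Smolensky.CubeFn (ZMod 3) n :=
  fun i => ∑ t : ZMod 3, ind (fun y => decide (lvl y = t)) *
    ind (foldBit (wsel (r + 1 - t)) (αsel (r + 1 - t)) (βsel (r + 1 - t)) (asel (r + 1 - t)) (bsel (r + 1 - t)) P i)

/-- The steering embedding `y ↦ pad (w_{r+1-|y|}) y`. -/
def spliceEmb (r : ZMod 3) (y : Fin n → Bool) : Fin (n + 6) → Bool := pad (wsel (r + 1 - lvl y)) y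

/-- SteerDial helper `splice_bits` (lens-5 g7 SteerDial twin; see the enclosing section docstring). -/
theorem splice_bits (r : ZMod 3) (P : Fin (n + 6) → Smolensky.CubeFn (ZMod 3) (n + 6)) (y : Fin n → Bool) (i : Fin n) :
    decide (splice r P i y = 1) =
      foldOut n (αsel (r + 1 - lvl y)) (βsel (r + 1 - lvl y)) (asel (r + 1 - lvl y)) (bsel (r + 1 - lvl y))
        (bits P (spliceEmb r y)) i := by
  unfold splice
  rw [Finset.sum_apply, Fintype.sum_eq_single (lvl y)]
  · rw [Pi.mul_apply, show ind (fun y' : Fin n → Bool => decide (lvl y' = lvl y)) y = 1 by simp [ind], one_mul,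
      decide_ind_eq_one]
    rfl
  · intro t ht
    rw [Pi.mul_apply, show ind (fun y' : Fin n → Bool => decide (lvl y' = t)) y = 0 by
      simp only [ind, decide_eq_true_eq]; rw [if_neg (Ne.symm ht)], zero_mul]

/-- Degree of the spliced strategy: `2 + 14d`. -/
theorem splice_mem_lowDeg {d : ℕ} (r : ZMod 3) {P : Fin (n + 6) → Smolensky.CubeFn (ZMod 3) (n + 6)}
    (hP : ∀ b, P b ∈ Smolensky.lowDeg (ZMod 3) (n + 6) d) (i : Fin n) :
    splice r P i ∈ Smolensky.lowDeg (ZMod 3) n (2 + 14 * d) := by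
  unfold splice
  exact Submodule.sum_mem _ fun t _ =>
    Smolensky.mul_mem_lowDeg_add (ind_lvl_mem_lowDeg t) (ind_foldBit_mem_lowDeg _ _ _ _ _ hP i)

/-- SteerDial helper `lvl_spliceEmb` (lens-5 g7 SteerDial twin; see the enclosing section docstring). -/
theorem lvl_spliceEmb (r : ZMod 3) (y : Fin n → Bool) : lvl (spliceEmb r y) = r + 1 := by
  unfold spliceEmb
  rw [lvl_pad, lvl_wsel]
  ring

/-- SteerDial helper `spliceEmb_injective` (lens-5 g7 SteerDial twin; see the enclosing section docstring). -/
theorem spliceEmb_injective (r : ZMod 3) : Function.Injective (spliceEmb (n := n) r) := by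
  intro y y' h
  funext i
  have := congrFun h (Fin.castAdd 6 i)
  simpa [spliceEmb, pad_castAdd] using this

/-- **Loss transport**: a loss of the spliced strategy at `y` is a loss of `P` at the steered pattern. -/
theorem loss_transport (hn : 3 ≤ n) (r : ZMod 3) (P : Fin (n + 6) → Smolensky.CubeFn (ZMod 3) (n + 6)) (y : Fin n → Bool)
    (hloss : ¬ RingHLF.Rel y (fun i => decide (splice r P i y = 1))) :
    ¬ RingHLF.Rel (spliceEmb r y) (fun b => decide (P b (spliceEmb r y) = 1)) := by
  intro hwin
  apply hloss
  have hf : (fun i => decide (splice r P i y = 1)) =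
      foldOut n (αsel (r + 1 - lvl y)) (βsel (r + 1 - lvl y)) (asel (r + 1 - lvl y)) (bsel (r + 1 - lvl y))
        (bits P (spliceEmb r y)) := funext fun i => splice_bits r P y i
  rw [hf]
  exact rel_fold hn (by norm_num) (wordCert_sel (r + 1 - lvl y)) y (bits P (spliceEmb r y)) hwin

/-- **Loss count transport**: the spliced strategy loses at most as often as `P` loses INSIDE the single level class
`{|x| ≡ r + 1 (mod 3)}` (the splice embedding lands exactly there). -/
theorem card_loss_splice_le (hn : 3 ≤ n) (r : ZMod 3) (P : Fin (n + 6) → Smolensky.CubeFn (ZMod 3) (n + 6)) :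
    (univ.filter fun y : Fin n → Bool => ¬ RingHLF.Rel y (fun i => decide (splice r P i y = 1))).card ≤
      (univ.filter fun x : Fin (n + 6) → Bool =>
        lvl x = r + 1 ∧ ¬ RingHLF.Rel x (fun b => decide (P b x = 1))).card := by
  refine Finset.card_le_card_of_injOn (spliceEmb r) (fun y hy => ?_) (fun y _ y' _ h => spliceEmb_injective r h)
  rw [Finset.mem_coe, Finset.mem_filter] at hy ⊢
  exact ⟨mem_univ _, lvl_spliceEmb r y, loss_transport hn r P y hy.2⟩

/-- Wins plus losses. -/
theorem card_win_add_card_loss {N : ℕ} (S : (Fin N → Bool) → Prop) [DecidablePred S] :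
    ((univ.filter fun x : Fin N → Bool => S x).card : ℝ) + ((univ.filter fun x : Fin N → Bool => ¬ S x).card : ℝ) = (2 : ℝ) ^ N := by
  have h := Finset.card_filter_add_card_filter_not (s := (univ : Finset (Fin N → Bool))) (fun x => S x)
  have hu : (univ : Finset (Fin N → Bool)).card = 2 ^ N := by simp
  rw [hu] at h
  exact_mod_cast h

/-- Degree budget for the splice: `2 + 14 (log₂(n+6))^c ≤ (log₂ n)^(2c+1)` for `n ≥ 2^16`. -/
theorem degree_budget (c : ℕ) : ∀ n ≥ 2 ^ 16, 2 + 14 * (Nat.log 2 (n + 6)) ^ c ≤ (Nat.log 2 n) ^ (2 * c + 1) := by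
  intro n hn
  set L := Nat.log 2 n with hL
  have hL16 : 16 ≤ L := Nat.le_log_of_pow_le (by norm_num) hn
  have hn0 : n ≠ 0 := by intro h; rw [h] at hn; norm_num at hn
  have hlog : Nat.log 2 (n + 6) ≤ L + 1 := by
    calc Nat.log 2 (n + 6) ≤ Nat.log 2 (n * 2) := Nat.log_mono_right (by omega)
      _ = L + 1 := by rw [Nat.log_mul_base (by norm_num) hn0]
  have h1 : (Nat.log 2 (n + 6)) ^ c ≤ L ^ (2 * c) := by
    calc (Nat.log 2 (n + 6)) ^ c ≤ (L + 1) ^ c := Nat.pow_le_pow_left hlog c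
      _ ≤ (2 * L) ^ c := Nat.pow_le_pow_left (by omega) c
      _ = 2 ^ c * L ^ c := by rw [Nat.mul_pow]
      _ ≤ L ^ c * L ^ c := Nat.mul_le_mul_right _ (Nat.pow_le_pow_left (by omega) c)
      _ = L ^ (2 * c) := by rw [← pow_add, two_mul]
  have h2 : 1 ≤ L ^ (2 * c) := Nat.one_le_pow _ _ (by omega)
  calc 2 + 14 * (Nat.log 2 (n + 6)) ^ c ≤ 2 + 14 * L ^ (2 * c) := by omega
    _ ≤ 16 * L ^ (2 * c) := by omega
    _ ≤ L * L ^ (2 * c) := Nat.mul_le_mul_right _ hL16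
    _ = L ^ (2 * c + 1) := by rw [pow_succ, mul_comm]

/-- **PROVED (the finite/base range of the lens): `PolyLoss3 →` «LevelSpread3» (text inlined)** — the loss set of every
polylog-degree `𝔽₃` strategy has `1/poly` mass INSIDE EVERY SINGLE Hamming level class `{|x| ≡ t (mod 3)}` (density `≈ 1/3`) — by
the identity-word fold and the level splice (steer with the certified word of weight `t - |y|`). Constants: `k ↦ k + 6`, `c ↦`
PolyLoss3 at `2c + 1`, `n₀ ↦ max n₀(2c+1) 2^16 + 6`.  (Single-class form: critic row 40's sharpening of the v1 co-class statement.) -/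
theorem levelSpread3_of_polyLoss3 (hP : SpreadDial.PolyLoss3) :
    ∃ k : ℕ, ∀ c : ℕ, ∃ n₀ : ℕ, ∀ n ≥ n₀, ∀ P : Fin n → Smolensky.CubeFn (ZMod 3) n,
      (∀ i, P i ∈ Smolensky.lowDeg (ZMod 3) n ((Nat.log 2 n) ^ c)) → ∀ t : ZMod 3,
        1 / (n : ℝ) ^ k * (2 : ℝ) ^ n ≤
          ((univ.filter fun x : Fin n → Bool =>
            lvl x = t ∧ ¬ RingHLF.Rel x (fun i => decide (P i x = 1))).card : ℝ) := by
  obtain ⟨k, hk⟩ := hP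
  refine ⟨k + 6, fun c => ?_⟩
  obtain ⟨n₀, hn₀⟩ := hk (2 * c + 1)
  refine ⟨max n₀ (2 ^ 16) + 6, fun N hN P hPdeg t => ?_⟩
  obtain ⟨n, rfl⟩ : ∃ n, N = n + 6 := ⟨N - 6, by omega⟩
  -- steer INTO level `t`: fold along the identity word of weight `t - |y|`, i.e. splice with `r := t - 1`
  obtain ⟨r, rfl⟩ : ∃ r : ZMod 3, t = r + 1 := ⟨t - 1, by ring⟩
  have hn₀' : n₀ ≤ n := by have := le_max_left n₀ (2 ^ 16); omega
  have hn16 : 2 ^ 16 ≤ n := by have := le_max_right n₀ (2 ^ 16); omega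
  have hn3 : 3 ≤ n := le_trans (by norm_num) hn16
  -- the spliced strategy is a legal polylog-degree strategy on `C_n`
  have hSdeg : ∀ i, splice r P i ∈ Smolensky.lowDeg (ZMod 3) n ((Nat.log 2 n) ^ (2 * c + 1)) := fun i =>
    Smolensky.lowDeg_mono (degree_budget c n hn16) (splice_mem_lowDeg r hPdeg i)
  -- PolyLoss3: it loses on ≥ 2^n / n^k patterns
  have hwin := hn₀ n hn₀' (splice r P) hSdeg
  have hsum := card_win_add_card_loss (fun y : Fin n → Bool => RingHLF.Rel y (fun i => decide (splice r P i y = 1)))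
  have hloss : 1 / (n : ℝ) ^ k * (2 : ℝ) ^ n ≤
      ((univ.filter fun y : Fin n → Bool => ¬ RingHLF.Rel y (fun i => decide (splice r P i y = 1))).card : ℝ) := by
    have e : (1 - 1 / (n : ℝ) ^ k) * (2 : ℝ) ^ n = (2 : ℝ) ^ n - 1 / (n : ℝ) ^ k * (2 : ℝ) ^ n := by ring
    linarith
  -- transport the losses to `P`, inside level `r + 1`
  have htr := card_loss_splice_le hn3 r P
  have htr' : ((univ.filter fun y : Fin n → Bool => ¬ RingHLF.Rel y (fun i => decide (splice r P i y = 1))).card : ℝ) ≤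
      ((univ.filter fun x : Fin (n + 6) → Bool =>
        lvl x = r + 1 ∧ ¬ RingHLF.Rel x (fun b => decide (P b x = 1))).card : ℝ) := by exact_mod_cast htr
  -- compare the normalisations `2^(n+6)/(n+6)^(k+6) ≤ 2^n/n^k`
  have hnpos : (0 : ℝ) < n := by exact_mod_cast (show 0 < n by omega)
  have hcmp : 1 / ((n + 6 : ℕ) : ℝ) ^ (k + 6) * (2 : ℝ) ^ (n + 6) ≤ 1 / (n : ℝ) ^ k * (2 : ℝ) ^ n := by
    have hNk : (n : ℝ) ^ k * 64 ≤ ((n + 6 : ℕ) : ℝ) ^ (k + 6) := by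
      push_cast
      rw [pow_add]
      have h64 : (64 : ℝ) ≤ ((n : ℝ) + 6) ^ 6 := by
        calc (64 : ℝ) = 2 ^ 6 := by norm_num
          _ ≤ ((n : ℝ) + 6) ^ 6 := pow_le_pow_left₀ (by norm_num) (by linarith) 6
      have hk' : (n : ℝ) ^ k ≤ ((n : ℝ) + 6) ^ k := pow_le_pow_left₀ hnpos.le (by linarith) k
      exact mul_le_mul hk' h64 (by norm_num) (by positivity)
    have hpos : (0 : ℝ) < (n : ℝ) ^ k * 64 := by positivity
    calc 1 / ((n + 6 : ℕ) : ℝ) ^ (k + 6) * (2 : ℝ) ^ (n + 6)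
        ≤ 1 / ((n : ℝ) ^ k * 64) * (2 : ℝ) ^ (n + 6) :=
          mul_le_mul_of_nonneg_right (one_div_le_one_div_of_le hpos hNk) (by positivity)
      _ = 1 / (n : ℝ) ^ k * (2 : ℝ) ^ n := by
          rw [pow_add]
          field_simp
          norm_num
  exact hcmp.trans (hloss.trans htr')

/-- ITEM-READY form of `levelSpread3_of_polyLoss3` — no auxiliary definitions (`lvl x` unfolded to
`∑ i, (if x i then 1 else 0) : ZMod 3`), so that a support item
«LevelWitness3 := SpreadDial.PolyLoss3 → …(this text)…» filed on route SpreadDial is closed by this theorem BY NAME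
(the BC5 witness of `AlgCover3` named in CRITIC row 40). -/
theorem levelWitness3 : SpreadDial.PolyLoss3 →
    ∃ k : ℕ, ∀ c : ℕ, ∃ n₀ : ℕ, ∀ n ≥ n₀, ∀ P : Fin n → Smolensky.CubeFn (ZMod 3) n,
      (∀ i, P i ∈ Smolensky.lowDeg (ZMod 3) n ((Nat.log 2 n) ^ c)) → ∀ t : ZMod 3,
        1 / (n : ℝ) ^ k * (2 : ℝ) ^ n ≤
          ((univ.filter fun x : Fin n → Bool =>
            (∑ i, (if x i then (1 : ZMod 3) else 0)) = t ∧
              ¬ RingHLF.Rel x (fun i => decide (P i x = 1))).card : ℝ) :=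
  fun hP => levelSpread3_of_polyLoss3 hP

end Level

/-! ## §S  The window dial: `PolyLoss3 ⇒` loss inside every identity-word cylinder (second PROVED instance) -/

section Window
variable {n : ℕ}

/-- The constant-word fold of `P` along a word `w` with certificate data `(α, β, a, b)`. -/
def wfold (w α β : Fin 6 → Bool) (a b : Bool) (P : Fin (n + 6) → Smolensky.CubeFn (ZMod 3) (n + 6)) :
    Fin n → Smolensky.CubeFn (ZMod 3) n :=
  fun i => ind (foldBit w α β a b P i)

/-- SteerDial helper `wfold_bits` (lens-5 g7 SteerDial twin; see the enclosing section docstring). -/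
theorem wfold_bits (w α β : Fin 6 → Bool) (a b : Bool) (P : Fin (n + 6) → Smolensky.CubeFn (ZMod 3) (n + 6))
    (y : Fin n → Bool) :
    (fun i => decide (wfold w α β a b P i y = 1)) = foldOut n α β a b (bits P (pad w y)) := by
  funext i
  unfold wfold
  rw [decide_ind_eq_one]
  rfl

/-- **Loss count transport along a certified word**: the fold loses at most as often as `P` loses inside the cylinder
`{x : x|_{[n,n+6)} = w}`. -/
theorem card_loss_wfold_le (hn : 3 ≤ n) {w α β : Fin 6 → Bool} {a b : Bool} (cert : wordCert w α β a b = true)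
    (P : Fin (n + 6) → Smolensky.CubeFn (ZMod 3) (n + 6)) :
    (univ.filter fun y : Fin n → Bool => ¬ RingHLF.Rel y (fun i => decide (wfold w α β a b P i y = 1))).card ≤
      (univ.filter fun x : Fin (n + 6) → Bool =>
        (∀ j : Fin 6, x (Fin.natAdd n j) = w j) ∧ ¬ RingHLF.Rel x (fun b' => decide (P b' x = 1))).card := by
  refine Finset.card_le_card_of_injOn (pad w) (fun y hy => ?_) (fun y _ y' _ h => ?_)
  · rw [Finset.mem_coe, Finset.mem_filter] at hy ⊢
    refine ⟨mem_univ _, fun j => pad_natAdd _ _ _, fun hwin => hy.2 ?_⟩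
    rw [wfold_bits]
    exact rel_fold hn (by norm_num) cert y _ hwin
  · funext i
    have := congrFun h (Fin.castAdd 6 i)
    simpa [pad_castAdd] using this

/-- **CylinderLoss3 (PROVED from PolyLoss3): no identity cylinder is (nearly) loss-free.**  For EVERY identity word
`w ∈ {0,1}^6` (all eleven, `wordCert_of_idWord6`) the loss set of every polylog-degree strategy on `C_{n+6}` has relative
density `≥ 2^6/(n+6)^{k+6}` inside the cylinder `{x : x|_{[n,n+6)} = w}` (`k ↦ k+6`, `c ↦ 2c+1`, `n₀ ↦ max n₀ 2^16`).
Consequently every test `{ψ = 1}` CONTAINING an identity cylinder — in particular every window-junta test of density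
`> 1 - 11/64` on that window, and every fixed-bit test `{x_b = 0}` / `{x_b = 1}` / `{x_b = x_{b+1}}` … compatible with one of
the eleven words — satisfies the ‹AlgSpread3› conclusion: the LOCAL range of ‹AlgCover3› (see `rotCylinderLoss3_of_polyLoss3`
for all ring offsets). -/
theorem cylinderLoss3_of_polyLoss3 (hP : SpreadDial.PolyLoss3) :
    ∃ k : ℕ, ∀ c : ℕ, ∃ n₀ : ℕ, ∀ n ≥ n₀, ∀ P : Fin (n + 6) → Smolensky.CubeFn (ZMod 3) (n + 6),
      (∀ b, P b ∈ Smolensky.lowDeg (ZMod 3) (n + 6) ((Nat.log 2 (n + 6)) ^ c)) → ∀ w : Fin 6 → Bool, (∀ s : St, monodromy (List.ofFn w) s = s) →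
        1 / ((n + 6 : ℕ) : ℝ) ^ k * (2 : ℝ) ^ (n + 6) ≤
          ((univ.filter fun x : Fin (n + 6) → Bool =>
            (∀ j : Fin 6, x (Fin.natAdd n j) = w j) ∧ ¬ RingHLF.Rel x (fun b => decide (P b x = 1))).card : ℝ) := by
  obtain ⟨k, hk⟩ := hP
  refine ⟨k + 6, fun c => ?_⟩
  obtain ⟨n₀, hn₀⟩ := hk (2 * c + 1)
  refine ⟨max n₀ (2 ^ 16), fun n hn P hPdeg w hw => ?_⟩
  have cert := wordCert_of_idWord6 w (decide_eq_true hw)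
  have hn₀' : n₀ ≤ n := le_trans (le_max_left _ _) hn
  have hn16 : 2 ^ 16 ≤ n := le_trans (le_max_right _ _) hn
  have hn3 : 3 ≤ n := le_trans (by norm_num) hn16
  set S := wfold (w := w) (cα w) (cβ w) (ca w) (cb w) P with hS
  have hSdeg : ∀ i, S i ∈ Smolensky.lowDeg (ZMod 3) n ((Nat.log 2 n) ^ (2 * c + 1)) := fun i =>
    Smolensky.lowDeg_mono ((Nat.le_add_left _ _).trans (degree_budget c n hn16)) (ind_foldBit_mem_lowDeg _ _ _ _ _ hPdeg i)
  have hwin := hn₀ n hn₀' S hSdeg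
  have hsum := card_win_add_card_loss (fun y : Fin n → Bool => RingHLF.Rel y (fun i => decide (S i y = 1)))
  have hloss : 1 / (n : ℝ) ^ k * (2 : ℝ) ^ n ≤
      ((univ.filter fun y : Fin n → Bool => ¬ RingHLF.Rel y (fun i => decide (S i y = 1))).card : ℝ) := by
    have e : (1 - 1 / (n : ℝ) ^ k) * (2 : ℝ) ^ n = (2 : ℝ) ^ n - 1 / (n : ℝ) ^ k * (2 : ℝ) ^ n := by ring
    linarith
  have htr' : ((univ.filter fun y : Fin n → Bool => ¬ RingHLF.Rel y (fun i => decide (S i y = 1))).card : ℝ) ≤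
      ((univ.filter fun x : Fin (n + 6) → Bool =>
        (∀ j : Fin 6, x (Fin.natAdd n j) = w j) ∧ ¬ RingHLF.Rel x (fun b => decide (P b x = 1))).card : ℝ) := by
    exact_mod_cast card_loss_wfold_le hn3 cert P
  have hnpos : (0 : ℝ) < n := by exact_mod_cast (show 0 < n by omega)
  have hcmp : 1 / ((n + 6 : ℕ) : ℝ) ^ (k + 6) * (2 : ℝ) ^ (n + 6) ≤ 1 / (n : ℝ) ^ k * (2 : ℝ) ^ n := by
    have hNk : (n : ℝ) ^ k * 64 ≤ ((n + 6 : ℕ) : ℝ) ^ (k + 6) := by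
      push_cast
      rw [pow_add]
      have h64 : (64 : ℝ) ≤ ((n : ℝ) + 6) ^ 6 := by
        calc (64 : ℝ) = 2 ^ 6 := by norm_num
          _ ≤ ((n : ℝ) + 6) ^ 6 := pow_le_pow_left₀ (by norm_num) (by linarith) 6
      have hk' : (n : ℝ) ^ k ≤ ((n : ℝ) + 6) ^ k := pow_le_pow_left₀ hnpos.le (by linarith) k
      exact mul_le_mul hk' h64 (by norm_num) (by positivity)
    have hpos : (0 : ℝ) < (n : ℝ) ^ k * 64 := by positivity
    calc 1 / ((n + 6 : ℕ) : ℝ) ^ (k + 6) * (2 : ℝ) ^ (n + 6)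
        ≤ 1 / ((n : ℝ) ^ k * 64) * (2 : ℝ) ^ (n + 6) :=
          mul_le_mul_of_nonneg_right (one_div_le_one_div_of_le hpos hNk) (by positivity)
      _ = 1 / (n : ℝ) ^ k * (2 : ℝ) ^ n := by
          rw [pow_add]
          field_simp
          norm_num
  exact hcmp.trans (hloss.trans htr')

/-- **WindowLoss3** (the v1 statement, now a corollary): the three selected cylinders `{x : x|_{[n,n+6)} = W_ρ}`. -/
theorem windowLoss3_of_polyLoss3 (hP : SpreadDial.PolyLoss3) :
    ∃ k : ℕ, ∀ c : ℕ, ∃ n₀ : ℕ, ∀ n ≥ n₀, ∀ P : Fin (n + 6) → Smolensky.CubeFn (ZMod 3) (n + 6),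
      (∀ b, P b ∈ Smolensky.lowDeg (ZMod 3) (n + 6) ((Nat.log 2 (n + 6)) ^ c)) → ∀ ρ : ZMod 3,
        1 / ((n + 6 : ℕ) : ℝ) ^ k * (2 : ℝ) ^ (n + 6) ≤
          ((univ.filter fun x : Fin (n + 6) → Bool =>
            (∀ j : Fin 6, x (Fin.natAdd n j) = wsel ρ j) ∧ ¬ RingHLF.Rel x (fun b => decide (P b x = 1))).card : ℝ) := by
  obtain ⟨k, hk⟩ := cylinderLoss3_of_polyLoss3 hP
  refine ⟨k, fun c => ?_⟩
  obtain ⟨n₀, hn₀⟩ := hk c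
  exact ⟨n₀, fun n hn P hPdeg ρ => hn₀ n hn P hPdeg (wsel ρ) (idWord_spec (idWord_of_wordCert (wordCert_sel ρ)))⟩

end Window

end Summit.QuantumAdvantage.QuantumAdvantage.Theorems.SteerDial
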